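import Summits.CriticalPhenomena.PercolationContinuityZ3.Theorems.PercNearOneGluingNoHeavyLowerTailKnQuestion8CoefficientwiseRootEdgeDomination
import Summits.CriticalPhenomena.PercolationContinuityZ3.Theorems.PercNearOneGluingNoHeavyLowerTailKnQuestion8CoefficientwiseCoreClassClusters
import HarnessLib

/-!
# Root-edge domination (REM): the pendant base case and the reduction to p-STAR DELETION MONOTONICITY — prim-lf-2 gen 67

Support file (`--supports stmt-CriticalPhenomena-4575`, closed), prover `prim-lf-2` (gen 67).  No definitions, no named facts, no sorries; standard axioms.
Memo `prim-lf-2/CW-FLIP-gen67.md` §5.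

Setting (CONJECTURE (REM), prim-lf-2 gen 66, `…CoefficientwiseRootEdgeDomination.lean`): finite multigraph `ends : ι → Sym2 V`, edge set `E`, root edge `e ∈ E`
with ends `{x,p}`, `p ≠ x`, target set `W`, `C_v(s) = openCluster (ends '' s) v`, and
`REM_E(e; x, W)[g] := Σ_{s ⊆ E : e ∈ s, ∀ w∈W ¬(w ∈ C_x s ∧ w ∈ C_x(E∖s))} (g(C_x s) − g(C_x(E∖s)))`.
* `Coefficientwise.rem_nonneg_of_pendant` — **BASE CASE**: if `e` is the only edge of `E` at `p`, then `REM ≥ 0` for monotone `g` (resolve `e`: `C_p(t) = {p}` and `p ∉ C_x(E'∖t)`,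
  so the event is the swap-invariant no-core event of `G − e` and `g(C_x t ∪ {p}) ≥ g(C_x t)`, whose swap-sum against `g(C_x(E'∖t))` vanishes).
* `Coefficientwise.rem_nonneg_of_pStarDeletion` — **REDUCTION**: if REM is monotone under deleting edges at `p` — for every edge set `E ∋ e` and every edge `f ∈ E`,
  `f ≠ e`, with `p ∈ ends f`: `REM_{E.erase f} ≤ REM_E` (un-normalised sums; CONJECTURE (PD) of the memo) — then `REM_E ≥ 0` for every `E ∋ e`
  (induction on the number of edges at `p` other than `e`, base `rem_nonneg_of_pendant`).
CONJECTURE (PD) (prim-lf-2 gen 67): exact census (one min-closure per `(G,e,f,W)`): all rooted connected simple graphs on ≤ 6 vertices (74 927 cases), on 7 vertices with ≤ 10 edges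
(145 278 cases, 4 of 16 shards), random multigraphs with parallel root edges and loops (5 309 cases), the LOBE(a,b)+leaf family (560 cases): 0 failures; the analogous CONTRACTION
statement and deletion at non-`p` edges fail already on 5 vertices.
[cite: KozmaNitzan2024, Questions 8–9 (§5.5 p. 36) (context: the Question-8 pocket covariance programme)]
-/

namespace Summit.CriticalPhenomena.PercolationContinuityZ3.Theorems

open Finset Literature.Probability.Percolation

namespace Coefficientwise

variable {ι V : Type*} [DecidableEq ι] (ends : ι → Sym2 V)

open Classical in
/-- **Base case: `p` pendant.**  If `e ∈ E` has ends `{x,p}` (`p ≠ x`) and no other edge of `E` contains `p`, then for every `W` and monotone `g`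
`0 ≤ Σ_{s ⊆ E : e ∈ s, Ev_W(s)} (g(C_x s) − g(C_x(E∖s)))`.  [cite: KozmaNitzan2024, Questions 8–9 (§5.5 p. 36) (context)] -/
theorem rem_nonneg_of_pendant (E : Finset ι) {e : ι} (he : e ∈ E) {x p : V} (hxp : ends e = s(x, p)) (hpx : p ≠ x)
    (hpend : ∀ f ∈ E.erase e, p ∉ ends f) (W : Set V) (g : Set V → ℝ) (hg : Monotone g) :
    0 ≤ ∑ s ∈ E.powerset.filter (fun s : Finset ι => e ∈ s ∧
          ∀ w ∈ W, ¬ (w ∈ openCluster (ends '' (↑s : Set ι)) x ∧ w ∈ openCluster (ends '' (↑(E \ s) : Set ι)) x)),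
      (g (openCluster (ends '' (↑s : Set ι)) x) - g (openCluster (ends '' (↑(E \ s) : Set ι)) x)) := by
  rw [rem_eq_sum_erase ends E he hxp hpx W g]
  set E' : Finset ι := E.erase e with hE'
  set K : Finset ι → Set V := fun t => openCluster (ends '' (↑t : Set ι)) x with hK
  -- on `G − e` the vertex `p` is isolated
  have hP : ∀ t, t ⊆ E' → openCluster (ends '' (↑t : Set ι)) p = {p} := fun t ht =>
    openCluster_eq_singleton_of_no_edge_at ends t (fun i hi => hpend i (ht hi))
  have hpB : ∀ t : Finset ι, p ∉ K (E' \ t) := fun t =>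
    not_mem_openCluster_of_no_edge_at ends (E' \ t) hpx.symm (fun i hi => hpend i (Finset.sdiff_subset hi))
  -- the event is the no-core event of `G − e`
  have hfilter : (E'.powerset.filter (fun t : Finset ι =>
        ∀ w ∈ W, ¬ (w ∈ openCluster (ends '' (↑t : Set ι)) x ∪ openCluster (ends '' (↑t : Set ι)) p ∧
          w ∈ openCluster (ends '' (↑(E' \ t) : Set ι)) x))) =
      (E'.powerset.filter (fun t : Finset ι => ∀ w ∈ W, ¬ (w ∈ K t ∧ w ∈ K (E' \ t)))) := by
    refine Finset.filter_congr fun t ht => ?_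
    have htE : t ⊆ E' := Finset.mem_powerset.mp ht
    rw [hP t htE]
    refine forall₂_congr fun w _ => not_congr ?_
    constructor
    · rintro ⟨hw1, hw2⟩
      rcases hw1 with h | h
      · exact ⟨h, hw2⟩
      · rw [Set.mem_singleton_iff] at h
        exact absurd (h ▸ hw2) (hpB t)
    · rintro ⟨hw1, hw2⟩
      exact ⟨Or.inl hw1, hw2⟩
  rw [hfilter]
  -- summands: g(K t ∪ {p}) − g(B t) = (g(K t ∪ {p}) − g(K t)) + (g(K t) − g(B t)); the second part sums to zero by the colour swap
  have hsummand : ∀ t ∈ E'.powerset.filter (fun t : Finset ι => ∀ w ∈ W, ¬ (w ∈ K t ∧ w ∈ K (E' \ t))),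
      (g (openCluster (ends '' (↑t : Set ι)) x ∪ openCluster (ends '' (↑t : Set ι)) p) - g (openCluster (ends '' (↑(E' \ t) : Set ι)) x)) =
        ((g (K t ∪ {p}) - g (K t)) + (g (K t) - g (K (E' \ t)))) := by
    intro t ht
    have htE : t ⊆ E' := Finset.mem_powerset.mp (Finset.mem_filter.mp ht).1
    rw [hP t htE]
    ring
  rw [Finset.sum_congr rfl hsummand, Finset.sum_add_distrib]
  have hflip : ∑ t ∈ E'.powerset.filter (fun t : Finset ι => ∀ w ∈ W, ¬ (w ∈ K t ∧ w ∈ K (E' \ t))),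
      (g (K t) - g (K (E' \ t))) = 0 := by
    have hsym : ∀ t, t ⊆ E' → ((∀ w ∈ W, ¬ (w ∈ K (E' \ t) ∧ w ∈ K (E' \ (E' \ t)))) ↔ (∀ w ∈ W, ¬ (w ∈ K t ∧ w ∈ K (E' \ t)))) := by
      intro t ht
      rw [Finset.sdiff_sdiff_eq_self ht]
      exact forall₂_congr fun w _ => not_congr and_comm
    have h := sum_powerset_filter_sdiff (E := E') (Q := fun t : Finset ι => ∀ w ∈ W, ¬ (w ∈ K t ∧ w ∈ K (E' \ t))) hsym (fun t => g (K t))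
    rw [Finset.sum_sub_distrib, sub_eq_zero]
    exact h.symm
  rw [hflip, add_zero]
  exact Finset.sum_nonneg fun t _ => sub_nonneg.mpr (hg Set.subset_union_left)

open Classical in
/-- **REDUCTION: p-star deletion monotonicity implies (REM).**  Fix `ends`, a root edge `e` with ends `{x,p}` (`p ≠ x`), `W` and a monotone `g`.  Suppose (PD): for every
edge set `E ∋ e` and every `f ∈ E` with `f ≠ e` and `p ∈ ends f`, `REM_{E.erase f}(e; x, W)[g] ≤ REM_E(e; x, W)[g]`.  Then `0 ≤ REM_E(e; x, W)[g]` for every `E ∋ e`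
(delete the edges at `p` one by one; the base case `p` pendant is `rem_nonneg_of_pendant`).  [cite: KozmaNitzan2024, Questions 8–9 (§5.5 p. 36) (context)] -/
theorem rem_nonneg_of_pStarDeletion {e : ι} {x p : V} (hxp : ends e = s(x, p)) (hpx : p ≠ x) (W : Set V) (g : Set V → ℝ) (hg : Monotone g)
    (hPD : ∀ (E : Finset ι) (f : ι), e ∈ E → f ∈ E → f ≠ e → p ∈ ends f →
      ∑ s ∈ (E.erase f).powerset.filter (fun s : Finset ι => e ∈ s ∧
            ∀ w ∈ W, ¬ (w ∈ openCluster (ends '' (↑s : Set ι)) x ∧ w ∈ openCluster (ends '' (↑((E.erase f) \ s) : Set ι)) x)),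
          (g (openCluster (ends '' (↑s : Set ι)) x) - g (openCluster (ends '' (↑((E.erase f) \ s) : Set ι)) x)) ≤
      ∑ s ∈ E.powerset.filter (fun s : Finset ι => e ∈ s ∧
            ∀ w ∈ W, ¬ (w ∈ openCluster (ends '' (↑s : Set ι)) x ∧ w ∈ openCluster (ends '' (↑(E \ s) : Set ι)) x)),
          (g (openCluster (ends '' (↑s : Set ι)) x) - g (openCluster (ends '' (↑(E \ s) : Set ι)) x)))
    (E : Finset ι) (he : e ∈ E) :
    0 ≤ ∑ s ∈ E.powerset.filter (fun s : Finset ι => e ∈ s ∧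
          ∀ w ∈ W, ¬ (w ∈ openCluster (ends '' (↑s : Set ι)) x ∧ w ∈ openCluster (ends '' (↑(E \ s) : Set ι)) x)),
      (g (openCluster (ends '' (↑s : Set ι)) x) - g (openCluster (ends '' (↑(E \ s) : Set ι)) x)) := by
  -- induction on the number of edges at `p` other than `e`
  suffices h : ∀ (n : ℕ) (E : Finset ι), e ∈ E → (E.filter (fun f : ι => f ≠ e ∧ p ∈ ends f)).card = n →
      0 ≤ ∑ s ∈ E.powerset.filter (fun s : Finset ι => e ∈ s ∧
          ∀ w ∈ W, ¬ (w ∈ openCluster (ends '' (↑s : Set ι)) x ∧ w ∈ openCluster (ends '' (↑(E \ s) : Set ι)) x)),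
        (g (openCluster (ends '' (↑s : Set ι)) x) - g (openCluster (ends '' (↑(E \ s) : Set ι)) x)) from
    h _ E he rfl
  intro n
  induction n with
  | zero =>
    intro E he hcard
    have hnone : ∀ f ∈ E.erase e, p ∉ ends f := by
      intro f hf hpf
      have hmem : f ∈ E.filter (fun f : ι => f ≠ e ∧ p ∈ ends f) :=
        Finset.mem_filter.mpr ⟨Finset.mem_of_mem_erase hf, Finset.ne_of_mem_erase hf, hpf⟩
      rw [Finset.card_eq_zero] at hcard
      rw [hcard] at hmem
      exact Finset.notMem_empty f hmem
    exact rem_nonneg_of_pendant ends E he hxp hpx hnone W g hg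
  | succ n ih =>
    intro E he hcard
    obtain ⟨f, hf⟩ : (E.filter (fun f : ι => f ≠ e ∧ p ∈ ends f)).Nonempty := by
      rw [← Finset.card_pos, hcard]; exact Nat.succ_pos n
    have hfE : f ∈ E := (Finset.mem_filter.mp hf).1
    have hfe : f ≠ e := (Finset.mem_filter.mp hf).2.1
    have hpf : p ∈ ends f := (Finset.mem_filter.mp hf).2.2
    have he' : e ∈ E.erase f := Finset.mem_erase.mpr ⟨hfe.symm, he⟩
    have hcard' : ((E.erase f).filter (fun f' : ι => f' ≠ e ∧ p ∈ ends f')).card = n := by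
      have hEq : (E.erase f).filter (fun f' : ι => f' ≠ e ∧ p ∈ ends f') = (E.filter (fun f' : ι => f' ≠ e ∧ p ∈ ends f')).erase f := by
        rw [Finset.filter_erase]
      rw [hEq, Finset.card_erase_of_mem hf, hcard]
      rfl
    exact le_trans (ih (E.erase f) he' hcard') (hPD E f he hfE hfe hpf)

end Coefficientwise

end Summit.CriticalPhenomena.PercolationContinuityZ3.Theorems
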